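import Mathlib
import HarnessLib
import Summits.HubbardSuperconductivity.HubbardSuperconductivity.Theorems.KLProgrammeKLRegimeEngineLadderFlow

/-!
# Route `KLProgramme` — crux K3, ENGINE child gen 8 (stmt-HubbardSuperconductivity-20437 `KLRegimeEngineV17F2`), stub (c) `stub_engine_step_values`,
# (R47h) v2 / RIDER (A): the Bethe–Salpeter DEFECTS of a Riccati flow at every time — `kltc_bsDefect_right_le`, `kltc_bsDefect_left_le`

Cell gate-hubbard-kl, seat hubbard-kl-k3c1-p1 (g9), technique «composed-map remainder propagation».

`kltc_tangent_duhamel` (`…EnginePairLadderTangentDuhamel`, p545005) takes as hypotheses entrywise bounds on the two dressers' Bethe–Salpeter defects along the slice,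
`‖(Γ(t)·(1 + diag(b(t)−b(0))·Γ(0)) − Γ(0))(x,y)‖ ≤ η` (right) and `‖((1 + Γ(0)·diag(b(t)−b(0)))·Γ(t) − Γ(0))(x,y)‖ ≤ η` (left), for ALL `t ∈ [0,1]`.  When the dresser
runs a pair-ladder Riccati flow `Γ̇ = −Γ·diag ḃ·Γ + X` with `|Γ| ≤ m`, rate `Σ‖ḃ‖ ≤ β`, accumulated mass `Σ‖b(t) − b(0)‖ ≤ Z`, `mβ ≤ 1/3`, `mZ ≤ 1/3` and `|X| ≤ ξ` entrywise,
both defects are `≤ (8/3)·ξ` at every `t` — the internal estimate of `kllf_duhamel` (p483410), which exported it at `t = 1` only and only through the step bound.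
This file exports it: `kltc_bsDefect_right_le` (the defect solves the LINEAR equation `Ṙ = X·(1 + diag(b−b(0))·Γ(0)) − Γ·diag ḃ·R`, `R(0) = 0`; Gronwall in the Pi sup
norm, monotonicity of `gronwallBound` in time) and `kltc_bsDefect_left_le` (the same for the transposed flow: `Γᵀ` runs the same Riccati equation since the rungs are
diagonal).  With these, the `η_i` of `kltc_tangent_duhamel` are `(8/3)·ξ_i` for dressers given by flow data of the standard KLTC shape.

Real analysis + matrix algebra only; nothing about the model is asserted.  0 kit.
-/

noncomputable section

namespace Summit.HubbardSuperconductivity.HubbardSuperconductivity.Theorems.KLRegimeSplit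

set_option linter.dupNamespace false -- summit = problem name (single-conjunct summit), D-0017

open Finset Matrix Set

section Generic

variable {ι : Type*} [Fintype ι] [DecidableEq ι]

set_option maxHeartbeats 800000 in
/-- **Right Bethe–Salpeter defect of a Riccati flow, at every time.**  `Γ, Γ̇ : ℝ → Matrix ι ι ℂ`, `b, ḃ : ℝ → ι → ℂ` with, for every `t ∈ [0,1]`: entrywise
derivatives; `|Γ(t)| ≤ m`; `Σ_a ‖ḃ t a‖ ≤ β`; `Σ_a ‖b t a − b 0 a‖ ≤ Z`; `m·β ≤ 1/3`, `m·Z ≤ 1/3`; `|Γ̇(t) + Γ(t)·diag(ḃ t)·Γ(t)| ≤ ξ` entrywise.  Then for every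
`t ∈ [0,1]`: `‖(Γ(t)·(1 + diag(b(t) − b(0))·Γ(0)) − Γ(0))(x,y)‖ ≤ (8/3)·ξ`. -/
theorem kltc_bsDefect_right_le (Γ Γ' : ℝ → Matrix ι ι ℂ) (b b' : ℝ → ι → ℂ) {m β Z ξ : ℝ} (hm : 0 ≤ m) (hξ : 0 ≤ ξ)
    (hΓ : ∀ t ∈ Icc (0 : ℝ) 1, ∀ x y, HasDerivAt (fun s => Γ s x y) (Γ' t x y) t)
    (hb : ∀ t ∈ Icc (0 : ℝ) 1, ∀ a, HasDerivAt (fun s => b s a) (b' t a) t)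
    (hΓm : ∀ t ∈ Icc (0 : ℝ) 1, ∀ x y, ‖Γ t x y‖ ≤ m) (hβ : ∀ t ∈ Icc (0 : ℝ) 1, ∑ a, ‖b' t a‖ ≤ β)
    (hZ : ∀ t ∈ Icc (0 : ℝ) 1, ∑ a, ‖b t a - b 0 a‖ ≤ Z) (hmβ : m * β ≤ 1 / 3) (hmZ : m * Z ≤ 1 / 3)
    (hX : ∀ t ∈ Icc (0 : ℝ) 1, ∀ x y, ‖Γ' t x y + (Γ t * diagonal (b' t) * Γ t) x y‖ ≤ ξ)
    (t : ℝ) (ht : t ∈ Icc (0 : ℝ) 1) (x y : ι) :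
    ‖(Γ t * (1 + diagonal (fun a => b t a - b 0 a) * Γ 0) - Γ 0) x y‖ ≤ 8 / 3 * ξ := by
  -- the step weight and its smallness
  set w : ℝ → ι → ℂ := fun t a => b t a - b 0 a with hw_def
  have hZ0 : 0 ≤ Z := le_trans (sum_nonneg fun a _ => norm_nonneg _) (hZ 0 (by norm_num))
  have hβ0 : 0 ≤ β := le_trans (sum_nonneg fun a _ => norm_nonneg _) (hβ 0 (by norm_num))
  -- the Bethe–Salpeter defect `R(t) = Γ(t)·(1 + diag(w t)·Γ 0) − Γ 0` and its derivative
  set R : ℝ → Matrix ι ι ℂ := fun t => Γ t * (1 + diagonal (w t) * Γ 0) - Γ 0 with hR_def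
  set R' : ℝ → Matrix ι ι ℂ := fun t => Γ' t * (1 + diagonal (w t) * Γ 0) + Γ t * diagonal (b' t) * Γ 0 with hR'_def
  set X : ℝ → Matrix ι ι ℂ := fun t => Γ' t + Γ t * diagonal (b' t) * Γ t with hX_def
  -- the LINEAR equation: `R' = X·(1 + diag w·Γ 0) − Γ·diag ḃ·R`
  have hlin : ∀ t, R' t = X t * (1 + diagonal (w t) * Γ 0) - Γ t * diagonal (b' t) * R t := by
    intro t
    simp only [hR'_def, hX_def, hR_def]
    noncomm_ring
  -- entrywise derivative of `R`
  have hRderiv : ∀ t ∈ Icc (0 : ℝ) 1, ∀ x y, HasDerivAt (fun s => R s x y) (R' t x y) t := by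
    intro t ht x y
    have hentry : ∀ s, R s x y = (∑ a, Γ s x a * ((1 : Matrix ι ι ℂ) a y + w s a * Γ 0 a y)) - Γ 0 x y := by
      intro s
      simp only [hR_def, Matrix.sub_apply]
      rw [Matrix.mul_apply]
      simp only [Matrix.add_apply, Matrix.diagonal_mul]
    have hentry' : R' t x y = ∑ a, (Γ' t x a * ((1 : Matrix ι ι ℂ) a y + w t a * Γ 0 a y) + Γ t x a * (b' t a * Γ 0 a y)) := by
      simp only [hR'_def, Matrix.add_apply]
      rw [Matrix.mul_apply, klli_mul_diag_mul_apply, ← sum_add_distrib]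
      refine sum_congr rfl fun a _ => ?_
      simp only [Matrix.add_apply, Matrix.diagonal_mul]
      ring
    have hws : ∀ a, HasDerivAt (fun s => w s a) (b' t a) t := by
      intro a
      have := (hb t ht a).sub_const (b 0 a)
      simpa [hw_def] using this
    have hterm : ∀ a, HasDerivAt (fun s => Γ s x a * ((1 : Matrix ι ι ℂ) a y + w s a * Γ 0 a y))
        (Γ' t x a * ((1 : Matrix ι ι ℂ) a y + w t a * Γ 0 a y) + Γ t x a * (b' t a * Γ 0 a y)) t := by
      intro a
      have h1 : HasDerivAt (fun s => Γ s x a) (Γ' t x a) t := hΓ t ht x a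
      have h2 : HasDerivAt (fun s => (1 : Matrix ι ι ℂ) a y + w s a * Γ 0 a y) (b' t a * Γ 0 a y) t := by
        have := ((hws a).mul_const (Γ 0 a y)).const_add ((1 : Matrix ι ι ℂ) a y)
        simpa using this
      exact h1.mul h2
    have hsum : HasDerivAt (fun s => ∑ a, Γ s x a * ((1 : Matrix ι ι ℂ) a y + w s a * Γ 0 a y))
        (∑ a, (Γ' t x a * ((1 : Matrix ι ι ℂ) a y + w t a * Γ 0 a y) + Γ t x a * (b' t a * Γ 0 a y))) t :=
      HasDerivAt.fun_sum (u := (Finset.univ : Finset ι)) fun a _ => hterm a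
    have hfull := hsum.sub_const (Γ 0 x y)
    rw [hentry']
    refine hfull.congr_of_eventuallyEq ?_
    exact Filter.Eventually.of_forall fun s => hentry s
  -- the Pi-valued curve `f t = (x,y) ↦ R t x y`
  set f : ℝ → (ι × ι → ℂ) := fun t p => R t p.1 p.2 with hf_def
  set f' : ℝ → (ι × ι → ℂ) := fun t p => R' t p.1 p.2 with hf'_def
  have hfderiv : ∀ t ∈ Icc (0 : ℝ) 1, HasDerivAt f (f' t) t := by
    intro t ht
    rw [hasDerivAt_pi]
    intro p
    exact hRderiv t ht p.1 p.2
  have hfcont : ContinuousOn f (Icc (0 : ℝ) 1) :=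
    fun t ht => (hfderiv t ht).continuousAt.continuousWithinAt
  have hf0 : ‖f 0‖ ≤ 0 := by
    have hd0 : Matrix.diagonal (w 0) = 0 := by
      ext i j
      by_cases h : i = j
      · subst h; simp [hw_def]
      · simp [Matrix.diagonal_apply_ne _ h]
    have : f 0 = 0 := by
      funext p
      show R 0 p.1 p.2 = 0
      have hR0 : R 0 = 0 := by
        show Γ 0 * (1 + Matrix.diagonal (w 0) * Γ 0) - Γ 0 = 0
        rw [hd0, zero_mul, add_zero, mul_one, sub_self]
      rw [hR0, Matrix.zero_apply]
    rw [this, norm_zero]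
  -- the differential inequality `‖f'‖ ≤ (m·β)·‖f‖ + (4/3)·ξ`
  have hbound : ∀ t ∈ Ico (0 : ℝ) 1, ‖f' t‖ ≤ (m * β) * ‖f t‖ + 4 / 3 * ξ := by
    intro t ht
    have ht' : t ∈ Icc (0 : ℝ) 1 := Ico_subset_Icc_self ht
    have hnn : 0 ≤ (m * β) * ‖f t‖ + 4 / 3 * ξ := by positivity
    rw [pi_norm_le_iff_of_nonneg hnn]
    rintro ⟨x, y⟩
    show ‖R' t x y‖ ≤ (m * β) * ‖f t‖ + 4 / 3 * ξ
    rw [hlin t, Matrix.sub_apply]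
    have hXe : ∀ a, ‖X t x a‖ ≤ ξ := fun a => by
      have := hX t ht' x a
      simpa [hX_def, Matrix.add_apply] using this
    have h1 : ‖(X t * (1 + Matrix.diagonal (w t) * Γ 0)) x y‖ ≤ 4 / 3 * ξ := by
      have hsplit : (X t * (1 + Matrix.diagonal (w t) * Γ 0)) x y = X t x y + ∑ a, X t x a * (w t a * Γ 0 a y) := by
        rw [mul_add, mul_one, Matrix.add_apply, Matrix.mul_apply]
        congr 1
        refine sum_congr rfl fun a _ => ?_
        rw [Matrix.diagonal_mul]
      rw [hsplit]
      calc ‖X t x y + ∑ a, X t x a * (w t a * Γ 0 a y)‖ ≤ ‖X t x y‖ + ∑ a, ‖X t x a * (w t a * Γ 0 a y)‖ :=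
            (norm_add_le _ _).trans (add_le_add le_rfl (norm_sum_le _ _))
        _ ≤ ξ + ∑ a, ξ * (‖w t a‖ * m) := by
            refine add_le_add (hXe y) (sum_le_sum fun a _ => ?_)
            rw [norm_mul, norm_mul]
            exact mul_le_mul (hXe a) (mul_le_mul_of_nonneg_left (hΓm 0 (by norm_num) a y) (norm_nonneg _))
              (mul_nonneg (norm_nonneg _) (norm_nonneg _)) hξ
        _ = ξ + ξ * ((∑ a, ‖w t a‖) * m) := by rw [← mul_sum, sum_mul]
        _ ≤ ξ + ξ * (1 / 3) := by
            refine add_le_add le_rfl (mul_le_mul_of_nonneg_left ?_ hξ)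
            calc (∑ a, ‖w t a‖) * m = m * ∑ a, ‖b t a - b 0 a‖ := by rw [mul_comm]
              _ ≤ m * Z := mul_le_mul_of_nonneg_left (hZ t ht') hm
              _ ≤ 1 / 3 := hmZ
        _ = 4 / 3 * ξ := by ring
    have h2 : ‖(Γ t * Matrix.diagonal (b' t) * R t) x y‖ ≤ (m * β) * ‖f t‖ := by
      rw [klli_mul_diag_mul_apply]
      calc ‖∑ c, Γ t x c * b' t c * R t c y‖ ≤ ∑ c, ‖Γ t x c * b' t c * R t c y‖ := norm_sum_le _ _
        _ ≤ ∑ c, m * ‖b' t c‖ * ‖f t‖ := by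
            refine sum_le_sum fun c _ => ?_
            rw [norm_mul, norm_mul]
            have hRc : ‖R t c y‖ ≤ ‖f t‖ := norm_le_pi_norm (f t) (c, y)
            exact mul_le_mul (mul_le_mul_of_nonneg_right (hΓm t ht' x c) (norm_nonneg _)) hRc (norm_nonneg _)
              (mul_nonneg hm (norm_nonneg _))
        _ = m * (∑ c, ‖b' t c‖) * ‖f t‖ := by rw [mul_sum, sum_mul]
        _ ≤ m * β * ‖f t‖ := by
            refine mul_le_mul_of_nonneg_right (mul_le_mul_of_nonneg_left (hβ t ht') hm) (norm_nonneg _)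
    calc ‖(X t * (1 + Matrix.diagonal (w t) * Γ 0)) x y - (Γ t * Matrix.diagonal (b' t) * R t) x y‖
        ≤ ‖(X t * (1 + Matrix.diagonal (w t) * Γ 0)) x y‖ + ‖(Γ t * Matrix.diagonal (b' t) * R t) x y‖ := norm_sub_le _ _
      _ ≤ 4 / 3 * ξ + (m * β) * ‖f t‖ := add_le_add h1 h2
      _ = (m * β) * ‖f t‖ + 4 / 3 * ξ := by ring
  -- Gronwall at time `t`, then monotonicity in time
  have hgron := norm_le_gronwallBound_of_norm_deriv_right_le (a := 0) (b := 1) hfcont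
    (fun s hs => (hfderiv s (Ico_subset_Icc_self hs)).hasDerivWithinAt) hf0 hbound t ht
  rw [sub_zero] at hgron
  have hK0 : 0 ≤ m * β := mul_nonneg hm hβ0
  have hK1 : m * β ≤ 1 := hmβ.trans (by norm_num)
  have hmono := gronwallBound_mono (δ := 0) (K := m * β) (ε := 4 / 3 * ξ) le_rfl (by positivity) hK0 ht.2
  have hRt : ‖f t‖ ≤ 8 / 3 * ξ := by
    refine (hgron.trans hmono).trans ((kllf_gronwall_const hK0 hK1 (by positivity)).trans ?_)
    linarith
  exact (norm_le_pi_norm (f t) (x, y)).trans hRt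

/-- **Left Bethe–Salpeter defect of a Riccati flow, at every time** — the transposed statement: under the same hypotheses,
`‖((1 + Γ(0)·diag(b(t) − b(0)))·Γ(t) − Γ(0))(x,y)‖ ≤ (8/3)·ξ` (`Γᵀ` runs the same Riccati equation, the rungs being diagonal). -/
theorem kltc_bsDefect_left_le (Γ Γ' : ℝ → Matrix ι ι ℂ) (b b' : ℝ → ι → ℂ) {m β Z ξ : ℝ} (hm : 0 ≤ m) (hξ : 0 ≤ ξ)
    (hΓ : ∀ t ∈ Icc (0 : ℝ) 1, ∀ x y, HasDerivAt (fun s => Γ s x y) (Γ' t x y) t)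
    (hb : ∀ t ∈ Icc (0 : ℝ) 1, ∀ a, HasDerivAt (fun s => b s a) (b' t a) t)
    (hΓm : ∀ t ∈ Icc (0 : ℝ) 1, ∀ x y, ‖Γ t x y‖ ≤ m) (hβ : ∀ t ∈ Icc (0 : ℝ) 1, ∑ a, ‖b' t a‖ ≤ β)
    (hZ : ∀ t ∈ Icc (0 : ℝ) 1, ∑ a, ‖b t a - b 0 a‖ ≤ Z) (hmβ : m * β ≤ 1 / 3) (hmZ : m * Z ≤ 1 / 3)
    (hX : ∀ t ∈ Icc (0 : ℝ) 1, ∀ x y, ‖Γ' t x y + (Γ t * diagonal (b' t) * Γ t) x y‖ ≤ ξ)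
    (t : ℝ) (ht : t ∈ Icc (0 : ℝ) 1) (x y : ι) :
    ‖((1 + Γ 0 * diagonal (fun a => b t a - b 0 a)) * Γ t - Γ 0) x y‖ ≤ 8 / 3 * ξ := by
  -- the transposed flow
  have hT : ∀ (A : Matrix ι ι ℂ) (d : ι → ℂ) (u v : ι), (A.transpose * diagonal d * A.transpose) u v = (A * diagonal d * A) v u := by
    intro A d u v
    rw [klli_mul_diag_mul_apply, klli_mul_diag_mul_apply]
    refine sum_congr rfl fun c _ => ?_
    rw [Matrix.transpose_apply, Matrix.transpose_apply]
    ring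
  have h := kltc_bsDefect_right_le (fun s => (Γ s).transpose) (fun s => (Γ' s).transpose) b b' hm hξ
    (fun s hs u v => hΓ s hs v u) hb (fun s hs u v => hΓm s hs v u) hβ hZ hmβ hmZ
    (fun s hs u v => by rw [Matrix.transpose_apply, hT]; exact hX s hs v u) t ht y x
  -- transpose back
  have hid : ((Γ t).transpose * (1 + diagonal (fun a => b t a - b 0 a) * (Γ 0).transpose) - (Γ 0).transpose) y x =
      ((1 + Γ 0 * diagonal (fun a => b t a - b 0 a)) * Γ t - Γ 0) x y := by
    have e : (Γ t).transpose * (1 + diagonal (fun a => b t a - b 0 a) * (Γ 0).transpose) - (Γ 0).transpose =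
        ((1 + Γ 0 * diagonal (fun a => b t a - b 0 a)) * Γ t - Γ 0).transpose := by
      rw [Matrix.transpose_sub, Matrix.transpose_mul, Matrix.transpose_add, Matrix.transpose_one, Matrix.transpose_mul,
        diagonal_transpose]
    rw [e, Matrix.transpose_apply]
  rw [← hid]
  exact h

end Generic

end Summit.HubbardSuperconductivity.HubbardSuperconductivity.Theorems.KLRegimeSplit

end
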